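import Summits.BirchSwinnertonDyer.BirchSwinnertonDyer.Theorems.GenusKolyvaginAtTwoPowDvdShaCardAtTwoRTTwinShaLaddersFinal
import Summits.BirchSwinnertonDyer.BirchSwinnertonDyer.Theorems.GenusKolyvaginAtTwoPowDvdShaCardAtTwoRTKolyvaginClassOrderGeneral
import Summits.BirchSwinnertonDyer.BirchSwinnertonDyer.Theorems.KolyvaginRoadThreeTowerFormPrintFree
import HarnessLib

/-!
# Route `GenusKolyvaginAtTwo`, LINE 18 (L_T `PowDvdShaCardAtTwoRT`, stmt-BirchSwinnertonDyer-23242), stub L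
# `stub_twinShaLaddersAtTwo` ⟸ (P52÷): McCALLUM'S PROP. 5.2 AT 2 IN KOLYVAGIN'S DIVISIBILITY CURRENCY

Seat `bsd-line-gk2-p2` g18 (PROVER seat 2/3, cell `bsd-f1-sign2`), `--supports stmt-BirchSwinnertonDyer-23242` (helper; closes
nothing). THEOREMS ONLY (no definition, no named fact, no `sorry`); BSD is not proved by any of this.

WHAT. The engine-facing form of the K-side hypothesis of stub L. `twinShaLadders_of_prop52DivAtTwo`: the conclusion of
`stub_twinShaLaddersAtTwo`, on the stub's own binders, from (P52÷) ALONE (asked only when `M₀ ≥ 1`), for the non-trivial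
`τ ∈ Aut(K/ℚ)`: `∃ L ≥ M₀+1, R ≥ 1, k : ℕ → ℕ` with `k R = L` and, for every depth `1 ≤ r ≤ R`, writing `M_r := L − k r`:
* `k r ≤ L`;
* (Kolyvagin's minimum, lower bound) `2^{M_r} ∣ P_d(n)` in `E(K[n])` for EVERY deep square-free depth-`r` level `n` (all primes Kolyvagin of
  index `≥ L`) and every datum `d` at `n`;
* (McCallum Prop. 5.2 at `2`, only when `M_r < L`) for every family `u` of `≤ r` classes of `Sel_{2^L}(E/K)` in the `ε_r = −w(E)(−1)^r`
  eigenspace of `τ`: a deep square-free depth-`r` level `n` and a datum `d` with `2^{M_r+1} ∤ P_d(n)` (so `2^{M_r} ∥ P_d(n)`) and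
  `⟨c_L(n)⟩ ∩ ⟨u⟩ = 0`.
At `r = R` (`M_R = 0`) the third item is a deep level with `2 ∤ P(n)` avoiding `⟨u⟩` — the bottom rung (stub L's shallow witness `hPn`
moved to deep primes by the prime-swapping loop).  NO class orders, NO ladder, NO annihilation statements are asked of the engines:
the order formula `ord c_L(n) = 2^{L−M_r}` (`addOrderOf_kolyvaginClass_two_eq_pow_sub`) and `2^{M_r} ∣ P(n′) ⟹ 2^{L−M_r} c_L(n′) = 0`
(`pow_zsmul_kolyvaginClass_two_eq_zero_iff`) are applied HERE, for a SINGLE datum (the divisor family those lemmas want is filled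
with `nonempty_kolyvaginHeegnerData_printFree`), and the ladder bookkeeping is the running minimum of `…RTKolyvaginSuppliesOfProp52`.

References: [McCallumLMS1991] §4 Cor. 4.5, §5 Lemma 5.1, Prop. 5.2, Thm. 5.4; [GrossLMS1991] §3, §4 (4.1), Prop. 3.6, Lemma 4.3.
-/

set_option autoImplicit false
-- the Theorems namespace of this sub repeats the summit name by design (D-0017 nested layout)
set_option linter.dupNamespace false

noncomputable section

open scoped Classical

namespace Summit.BirchSwinnertonDyer.BirchSwinnertonDyer.Theorems.GenusExact.PlusDescent

open WeierstrassCurve NumberField IsDedekindDomain Field Literature.NumberTheory.EllipticCurves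
  Literature.NumberTheory.GaloisRepresentations Literature.NumberTheory.EllipticCurves.ModularForms AddSubgroup
open Summit.BirchSwinnertonDyer.BirchSwinnertonDyer.Theses.GenusKolyvaginAtTwo (KolyvaginRelationAtTwo)

section SingleDatum

variable {W : WeierstrassCurve ℚ} [W.IsElliptic] [W.IsGloballyMinimal] [NeZero (W.conductorNorm ℤ)]
  {K : Type} [Field K] [NumberField K]
  {Dt : ModularParametrizationData W (W.conductorNorm ℤ)} {β : ℤ} {ι : K →+* ℂ}

/-- **A datum at a deep level extends to data at every divisor** (Kolyvagin–Heegner data exist at every square-free inert level,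
`nonempty_kolyvaginHeegnerData_printFree`; the orientation `4N ∣ β² − d_K` is read off the given datum). [cite: GrossLMS1991, §3, §4 (4.1)] -/
theorem exists_divisorFamily_eq (hK : IsImaginaryQuadratic K) (hH : SatisfiesHeegnerHypothesis (W.conductorNorm ℤ) K)
    {n : ℕ} (hn : Squarefree n) (hkol : ∀ q ∈ n.primeFactors, Zhang2014.IsKolyvaginPrime (W.conductorNorm ℤ) W K 2 q)
    (d : KolyvaginHeegnerData Dt β ι n) :
    ∃ dfam : (m : ℕ) → m ∣ n → KolyvaginHeegnerData Dt β ι m, dfam n dvd_rfl = d := by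
  have hne : ∀ m : ℕ, m ∣ n → Nonempty (KolyvaginHeegnerData Dt β ι m) := fun m hm ↦
    nonempty_kolyvaginHeegnerData_printFree hK hH Dt β ι d.dvd_sq_sub (hn.squarefree_of_dvd hm)
      (fun q hq ↦ (hkol q (Nat.primeFactors_mono hm hn.ne_zero hq)).2.2.2.2.1)
  refine ⟨fun m hm ↦ if h : m = n then h ▸ d else (hne m hm).some, ?_⟩
  simp

/-- **`2^{M−j} ∣ P_d(n) ⟹ 2^j · c_M(n) = 0` for a SINGLE datum** (McCallum Cor. 4.5 «if», on the crux's frame: `K` imaginary quadratic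
with odd `d_K ≠ −3`, Heegner, `ρ̄_{E,2}` onto, `n` square-free with all primes Kolyvagin of index `≥ M`).
[cite: McCallumLMS1991, §4 Cor. 4.5] [cite: GrossLMS1991, Prop. 3.6, Lemma 4.3] -/
theorem pow_zsmul_kolyvaginClass_two_eq_zero_of_dvd (hK : IsImaginaryQuadratic K) (hodd : Odd (NumberField.discr K))
    (h3 : NumberField.discr K ≠ -3) (hH : SatisfiesHeegnerHypothesis (W.conductorNorm ℤ) K)
    (hsurj : W.HasSurjectiveModNGaloisRep ((2 : ℤ) ^ 1)) {n M : ℕ} (hn : Squarefree n)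
    (hkol : ∀ q ∈ n.primeFactors, Zhang2014.IsKolyvaginPrime (W.conductorNorm ℤ) W K 2 q ∧ M ≤ Zhang2014.kolyvaginIndex W 2 q)
    (d : KolyvaginHeegnerData Dt β ι n) {j : ℕ} (hj : j ≤ M)
    (hdvd : ∃ B : (W.baseChange (ringClassField K ι n)).toAffine.Point, ((2 ^ (M - j) : ℕ) : ℤ) • B = d.derivedPoint) :
    ((2 ^ j : ℕ) : ℤ) • d.kolyvaginClass Nat.prime_two M = 0 := by
  obtain ⟨dfam, hdfam⟩ := exists_divisorFamily_eq hK hH hn (fun q hq ↦ (hkol q hq).1) d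
  have h := pow_zsmul_kolyvaginClass_two_eq_zero_iff (Dt := Dt) (β := β) (ι := ι) hK hodd h3 hH hsurj hn hkol dfam hj
  rw [hdfam] at h
  exact h.mpr hdvd

/-- **THE ORDER FORMULA for a SINGLE datum**: `2^k ∣ P_d(n)`, `2^{k+1} ∤ P_d(n)`, `k ≤ M` ⟹ `ord c_M(n) = 2^{M−k}` (McCallum, proof of
Prop. 5.2, first paragraph; the divisor-family version is `addOrderOf_kolyvaginClass_two_eq_pow_sub`).
[cite: McCallumLMS1991, §5 Prop. 5.2 (proof, first paragraph); §4 Cor. 4.5] -/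
theorem addOrderOf_kolyvaginClass_two_eq_pow_sub_single (hK : IsImaginaryQuadratic K) (hodd : Odd (NumberField.discr K))
    (h3 : NumberField.discr K ≠ -3) (hH : SatisfiesHeegnerHypothesis (W.conductorNorm ℤ) K)
    (hsurj : W.HasSurjectiveModNGaloisRep ((2 : ℤ) ^ 1)) {n M : ℕ} (hn : Squarefree n)
    (hkol : ∀ q ∈ n.primeFactors, Zhang2014.IsKolyvaginPrime (W.conductorNorm ℤ) W K 2 q ∧ M ≤ Zhang2014.kolyvaginIndex W 2 q)
    (d : KolyvaginHeegnerData Dt β ι n) {k : ℕ} (hkM : k ≤ M)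
    (hk : ∃ B : (W.baseChange (ringClassField K ι n)).toAffine.Point, ((2 ^ k : ℕ) : ℤ) • B = d.derivedPoint)
    (hk1 : ¬ ∃ B : (W.baseChange (ringClassField K ι n)).toAffine.Point, ((2 ^ (k + 1) : ℕ) : ℤ) • B = d.derivedPoint) :
    addOrderOf (d.kolyvaginClass Nat.prime_two M) = 2 ^ (M - k) := by
  obtain ⟨dfam, hdfam⟩ := exists_divisorFamily_eq hK hH hn (fun q hq ↦ (hkol q hq).1) d
  have h := addOrderOf_kolyvaginClass_two_eq_pow_sub (Dt := Dt) (β := β) (ι := ι) hK hodd h3 hH hsurj hn hkol dfam hkM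
  rw [hdfam] at h
  exact h hk hk1

end SingleDatum

/-- **Square-free divisor bookkeeping** (sibling of `squarefree_div_primeFactors` in `…RTKolyvaginSuppliesOfProp52`, restated to keep this file independent of it): for `ℓ` a prime factor of a square-free `n`, `n / ℓ` is square-free, its prime factors are
among those of `n`, and it has exactly one prime factor fewer. [cite: McCallumLMS1991, §3 (the sets S_r(M))] -/
theorem squarefree_div_primeFactors' {n : ℕ} (hn : Squarefree n) {ℓ : ℕ} (hℓ : ℓ ∈ n.primeFactors) :
    Squarefree (n / ℓ) ∧ (n / ℓ).primeFactors ⊆ n.primeFactors ∧ (n / ℓ).primeFactors.card + 1 = n.primeFactors.card := by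
  have hℓp : ℓ.Prime := Nat.prime_of_mem_primeFactors hℓ
  have hℓn : ℓ ∣ n := Nat.dvd_of_mem_primeFactors hℓ
  have hmul : ℓ * (n / ℓ) = n := Nat.mul_div_cancel' hℓn
  have hsq : Squarefree (ℓ * (n / ℓ)) := by rwa [hmul]
  obtain ⟨hcop, -, hsq'⟩ := Nat.squarefree_mul_iff.mp hsq
  refine ⟨hsq', Nat.primeFactors_mono (Nat.div_dvd_of_dvd hℓn) hn.ne_zero, ?_⟩
  have hunion := hcop.primeFactors_mul
  have hdisj := hcop.disjoint_primeFactors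
  rw [hmul, hℓp.primeFactors] at hunion
  rw [hℓp.primeFactors] at hdisj
  rw [hunion, Finset.card_union_of_disjoint hdisj, Finset.card_singleton, add_comm]

/-- **(KS) ⟸ (P52÷)**: the K-side hypothesis of `twinShaLadders_of_kolyvaginSuppliesAtTwo(')` from McCallum's Prop. 5.2 at `2` in
Kolyvagin's DIVISIBILITY currency (`M_r := L − k r` a lower bound of the `2`-divisibility of `P(n)` over deep depth-`r` levels, attained
— when `M_r < L` — together with the avoidance, for every `≤ r`-generated subgroup of `Sel_{2^L}(E/K)^{ε_r}`; bottom rung `M_R = 0`).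
Ladder = running minimum; orders by the single-datum order formula; annihilation one level down by the single-datum Cor. 4.5.
[cite: McCallumLMS1991, §5 Lemma 5.1, Prop. 5.2, p. 309; §4 Cor. 4.5] [cite: GrossLMS1991, §4 (4.1), Prop. 5.3] -/
theorem kolyvaginSuppliesAtTwo_of_prop52Div (W : WeierstrassCurve ℚ) [W.IsElliptic] [W.IsGloballyMinimal] [NeZero (W.conductorNorm ℤ)]
    (K : Type) [Field K] [NumberField K] (hIQ : IsImaginaryQuadratic K) (hodd : Odd (NumberField.discr K))
    (h3 : NumberField.discr K ≠ -3) (hHe : SatisfiesHeegnerHypothesis (W.conductorNorm ℤ) K)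
    (hsurj1 : W.HasSurjectiveModNGaloisRep ((2 : ℤ) ^ 1))
    (Dt : ModularParametrizationData W (W.conductorNorm ℤ)) (β : ℤ) (ι : K →+* ℂ) (d₁ : KolyvaginHeegnerData Dt β ι 1) (M₀ : ℕ)
    (hM₀ : ∃ Q : (W.baseChange (ringClassField K ι 1)).toAffine.Point, ((2 ^ M₀ : ℕ) : ℤ) • Q = d₁.derivedPoint)
    (hKS : ∀ τ : K ≃ₐ[ℚ] K, τ ≠ 1 → ∃ (L R : ℕ) (k : ℕ → ℕ), M₀ + 1 ≤ L ∧ 1 ≤ R ∧ k R = L ∧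
      ∀ r : ℕ, 1 ≤ r → r ≤ R →
        k r ≤ L ∧
        (∀ (n : ℕ) (d : KolyvaginHeegnerData Dt β ι n), Squarefree n →
          (∀ ℓ ∈ n.primeFactors, Zhang2014.IsKolyvaginPrime (W.conductorNorm ℤ) W K 2 ℓ ∧ L ≤ Zhang2014.kolyvaginIndex W 2 ℓ) →
          n.primeFactors.card = r →
          ∃ B : (W.baseChange (ringClassField K ι n)).toAffine.Point, ((2 ^ (L - k r) : ℕ) : ℤ) • B = d.derivedPoint) ∧
        (0 < k r → ∀ (i : ℕ) (u : Fin i → galH1Torsion (W.baseChange K) ((2 ^ L : ℕ) : ℤ)), i ≤ r →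
          (∀ j, u j ∈ selmerGroup (W.baseChange K) ((2 ^ L : ℕ) : ℤ) ∧
            conjAct W τ ((2 ^ L : ℕ) : ℤ) (u j) = (-W.rootNumber * (-1) ^ r) • u j) →
          ∃ (n : ℕ) (_ : Squarefree n)
            (_ : ∀ ℓ ∈ n.primeFactors, Zhang2014.IsKolyvaginPrime (W.conductorNorm ℤ) W K 2 ℓ ∧ L ≤ Zhang2014.kolyvaginIndex W 2 ℓ)
            (_ : n.primeFactors.card = r) (d : KolyvaginHeegnerData Dt β ι n),
            (¬ ∃ B : (W.baseChange (ringClassField K ι n)).toAffine.Point, ((2 ^ (L - k r + 1) : ℕ) : ℤ) • B = d.derivedPoint) ∧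
            Disjoint (zmultiples (d.kolyvaginClass Nat.prime_two L)) (AddSubgroup.closure (Set.range u)))) :
    ∀ τ : K ≃ₐ[ℚ] K, τ ≠ 1 → ∃ (L R : ℕ) (Mr : ℕ → ℕ), M₀ + 1 ≤ L ∧ (∀ j, Mr (j + 1) ≤ Mr j) ∧ Mr 0 = M₀ ∧ Mr R = 0 ∧
      (∀ m : ℕ, Mr (2 * m + 1) < Mr (2 * m) →
        ∀ (i : ℕ) (u : Fin i → galH1Torsion (W.baseChange K) ((2 ^ L : ℕ) : ℤ)), i ≤ 2 * m + 1 →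
        (∀ j, u j ∈ selmerGroup (W.baseChange K) ((2 ^ L : ℕ) : ℤ) ∧
          conjAct W τ ((2 ^ L : ℕ) : ℤ) (u j) = W.rootNumber • u j) →
        ∃ (n : ℕ) (_ : Squarefree n)
          (_ : ∀ ℓ ∈ n.primeFactors, Zhang2014.IsKolyvaginPrime (W.conductorNorm ℤ) W K 2 ℓ ∧ L ≤ Zhang2014.kolyvaginIndex W 2 ℓ)
          (d : KolyvaginHeegnerData Dt β ι n),
          (∀ ℓ ∈ n.primeFactors, ∀ e : KolyvaginHeegnerData Dt β ι (n / ℓ),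
            ((2 ^ (L - Mr (2 * m)) : ℕ) : ℤ) • e.kolyvaginClass Nat.prime_two L = 0) ∧
          addOrderOf (d.kolyvaginClass Nat.prime_two L) = 2 ^ (L - Mr (2 * m + 1)) ∧
          -W.rootNumber * (-1) ^ n.primeFactors.card = W.rootNumber ∧
          Disjoint (zmultiples (((2 ^ (L - Mr (2 * m)) : ℕ) : ℤ) • d.kolyvaginClass Nat.prime_two L))
            (AddSubgroup.closure (Set.range u))) ∧
      (∀ m : ℕ, Mr (2 * m + 2) < Mr (2 * m + 1) →
        ∀ (i : ℕ) (u : Fin i → galH1Torsion (W.baseChange K) ((2 ^ L : ℕ) : ℤ)), i ≤ 2 * m + 1 →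
        (∀ j, u j ∈ selmerGroup (W.baseChange K) ((2 ^ L : ℕ) : ℤ) ∧
          conjAct W τ ((2 ^ L : ℕ) : ℤ) (u j) = (-W.rootNumber) • u j) →
        ∃ (n : ℕ) (_ : Squarefree n)
          (_ : ∀ ℓ ∈ n.primeFactors, Zhang2014.IsKolyvaginPrime (W.conductorNorm ℤ) W K 2 ℓ ∧ L ≤ Zhang2014.kolyvaginIndex W 2 ℓ)
          (d : KolyvaginHeegnerData Dt β ι n),
          (∀ ℓ ∈ n.primeFactors, ∀ e : KolyvaginHeegnerData Dt β ι (n / ℓ),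
            ((2 ^ (L - Mr (2 * m + 1)) : ℕ) : ℤ) • e.kolyvaginClass Nat.prime_two L = 0) ∧
          addOrderOf (d.kolyvaginClass Nat.prime_two L) = 2 ^ (L - Mr (2 * m + 2)) ∧
          -W.rootNumber * (-1) ^ n.primeFactors.card = -W.rootNumber ∧
          Disjoint (zmultiples (((2 ^ (L - Mr (2 * m + 1)) : ℕ) : ℤ) • d.kolyvaginClass Nat.prime_two L))
            (AddSubgroup.closure (Set.range u) ⊔ zmultiples (d₁.kolyvaginClass Nat.prime_two L))) := by
  intro τ hτ
  obtain ⟨L, R, k, hML, hR1, hkR, hdepth⟩ := hKS τ hτ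
  have hM₀L : M₀ ≤ L := by omega
  have hL1 : 1 ≤ L := by omega
  have hn0 : ((2 ^ L : ℕ) : ℤ) ≠ 0 := by positivity
  have hne4 : NumberField.discr K ≠ -4 := by
    intro h
    have h' := Int.odd_iff.mp hodd
    rw [h] at h'
    omega
  -- the running-minimum ladder
  obtain ⟨Mr, hMr0, hMrS⟩ : ∃ Mr : ℕ → ℕ, Mr 0 = M₀ ∧ ∀ s, Mr (s + 1) = min (Mr s) (L - k (s + 1)) :=
    ⟨fun r ↦ Nat.rec (motive := fun _ ↦ ℕ) M₀ (fun s ih ↦ min ih (L - k (s + 1))) r, rfl, fun _ ↦ rfl⟩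
  have hstep : ∀ j, Mr (j + 1) ≤ Mr j := fun j ↦ by
    rw [hMrS]
    exact min_le_left _ _
  have hanti : ∀ a b, a ≤ b → Mr b ≤ Mr a := fun a b hab ↦ by
    induction hab with
    | refl => exact le_rfl
    | step _ ih => exact (hstep _).trans ih
  have hMrle : ∀ s, 1 ≤ s → Mr s ≤ L - k s := fun s hs ↦ by
    obtain ⟨t, rfl⟩ : ∃ t, s = t + 1 := ⟨s - 1, by omega⟩
    rw [hMrS]
    exact min_le_right _ _
  have hMrM₀ : ∀ s, Mr s ≤ M₀ := fun s ↦ hMr0 ▸ hanti 0 s (Nat.zero_le s)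
  have hMrR : Mr R = 0 := by
    have h := hMrle R hR1
    rw [hkR, Nat.sub_self] at h
    exact Nat.le_zero.mp h
  -- a drop at depth `s + 1` pins `Mr (s+1) = L - k (s+1)`, forces `s + 1 ≤ R` and `0 < k (s+1)`
  have hdrop : ∀ s, Mr (s + 1) < Mr s → Mr (s + 1) = L - k (s + 1) ∧ s + 1 ≤ R ∧ 0 < k (s + 1) := fun s hs ↦ by
    have heq : Mr (s + 1) = L - k (s + 1) := by
      rw [hMrS] at hs ⊢
      rcases le_total (Mr s) (L - k (s + 1)) with h | h
      · rw [min_eq_left h] at hs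
        exact absurd hs (lt_irrefl _)
      · exact min_eq_right h
    refine ⟨heq, ?_, ?_⟩
    · by_contra hlt
      have h := hanti R s (by omega)
      rw [hMrR] at h
      omega
    · have h := hMrM₀ s
      omega
  -- depth `0`: every conductor-`1` datum's class is killed by `2^(L - M₀)` (`2^{M₀} ∣ P(1) = y_K`, the same for all data)
  have hkill0 : ∀ m : ℕ, m = 1 → ∀ e : KolyvaginHeegnerData Dt β ι m,
      ((2 ^ (L - M₀) : ℕ) : ℤ) • e.kolyvaginClass Nat.prime_two L = 0 := by
    rintro m rfl e
    obtain ⟨Q, hQ⟩ := hM₀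
    exact pow_zsmul_kolyvaginClass_two_eq_zero_of_dvd hIQ hodd h3 hHe hsurj1 squarefree_one (by simp [Nat.primeFactors_one]) e
      (Nat.sub_le L M₀) ⟨Q, by
        rw [Nat.sub_sub_self hM₀L]
        exact hQ.trans (AdditiveKoly.derivedPoint_one_eq_derivedPoint_one W K Dt β ι d₁ e)⟩
  -- depth `r ≥ 1`: `2^{M_r} ∣ P(n′)` kills every deep depth-`r` class by `2^(L - Mr r)`
  have hkillr : ∀ r, 1 ≤ r → r ≤ R → ∀ (n : ℕ) (e : KolyvaginHeegnerData Dt β ι n), Squarefree n →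
      (∀ ℓ ∈ n.primeFactors, Zhang2014.IsKolyvaginPrime (W.conductorNorm ℤ) W K 2 ℓ ∧ L ≤ Zhang2014.kolyvaginIndex W 2 ℓ) →
      n.primeFactors.card = r → ((2 ^ (L - Mr r) : ℕ) : ℤ) • e.kolyvaginClass Nat.prime_two L = 0 := by
    intro r hr1 hrR n e hn hdeep hcard
    obtain ⟨hkL, hbound, -⟩ := hdepth r hr1 hrR
    have hle := hMrle r hr1
    have hkey : ((2 ^ k r : ℕ) : ℤ) • e.kolyvaginClass Nat.prime_two L = 0 :=
      pow_zsmul_kolyvaginClass_two_eq_zero_of_dvd hIQ hodd h3 hHe hsurj1 hn hdeep e hkL (hbound n e hn hdeep hcard)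
    have hsplit : ((2 ^ (L - Mr r) : ℕ) : ℤ) = ((2 ^ (L - Mr r - k r) : ℕ) : ℤ) * ((2 ^ k r : ℕ) : ℤ) := by
      rw [← Nat.cast_mul, ← pow_add, Nat.sub_add_cancel (by omega)]
    rw [hsplit, mul_smul, hkey]
    exact zsmul_zero _
  -- the annihilation one level down, at a deep level of depth `p + 1`
  have hkill : ∀ p : ℕ, p + 1 ≤ R → ∀ (n : ℕ), Squarefree n →
      (∀ ℓ ∈ n.primeFactors, Zhang2014.IsKolyvaginPrime (W.conductorNorm ℤ) W K 2 ℓ ∧ L ≤ Zhang2014.kolyvaginIndex W 2 ℓ) →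
      n.primeFactors.card = p + 1 → ∀ ℓ ∈ n.primeFactors, ∀ e : KolyvaginHeegnerData Dt β ι (n / ℓ),
        ((2 ^ (L - Mr p) : ℕ) : ℤ) • e.kolyvaginClass Nat.prime_two L = 0 := by
    intro p hpR n hn hdeep hcard ℓ hℓ e
    obtain ⟨hsq', hsub, hcard'⟩ := squarefree_div_primeFactors' hn hℓ
    rcases Nat.eq_zero_or_pos p with rfl | hp
    · -- `n = ℓ` is prime: `n / ℓ = 1`
      have h0 : (n / ℓ).primeFactors = ∅ := Finset.card_eq_zero.mp (by omega)
      have h1 : n / ℓ = 1 := by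
        rcases Nat.primeFactors_eq_empty.mp h0 with h | h
        · rw [h] at hsq'
          exact absurd hsq' not_squarefree_zero
        · exact h
      rw [hMr0]
      exact hkill0 (n / ℓ) h1 e
    · exact hkillr p hp (by omega) (n / ℓ) e hsq' (fun q hq ↦ hdeep q (hsub hq)) (by omega)
  -- the exact order of a witness from `2^{M_r} ∥ P(n)`
  have horder : ∀ r, 1 ≤ r → r ≤ R → ∀ (n : ℕ) (d : KolyvaginHeegnerData Dt β ι n), Squarefree n →
      (∀ ℓ ∈ n.primeFactors, Zhang2014.IsKolyvaginPrime (W.conductorNorm ℤ) W K 2 ℓ ∧ L ≤ Zhang2014.kolyvaginIndex W 2 ℓ) →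
      n.primeFactors.card = r →
      (¬ ∃ B : (W.baseChange (ringClassField K ι n)).toAffine.Point, ((2 ^ (L - k r + 1) : ℕ) : ℤ) • B = d.derivedPoint) →
      addOrderOf (d.kolyvaginClass Nat.prime_two L) = 2 ^ k r := by
    intro r hr1 hrR n d hn hdeep hcard hk1
    obtain ⟨hkL, hbound, -⟩ := hdepth r hr1 hrR
    rw [← Nat.sub_sub_self hkL]
    exact addOrderOf_kolyvaginClass_two_eq_pow_sub_single hIQ hodd h3 hHe hsurj1 hn hdeep d (Nat.sub_le L (k r))
      (hbound n d hn hdeep hcard) hk1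
  refine ⟨L, R, Mr, hML, hstep, hMr0, hMrR, fun m hm i u hi hu ↦ ?_, fun m hm i u hi hu ↦ ?_⟩
  · -- odd depth `2m + 1`, sign `w(E)`
    obtain ⟨hMreq, hrR, hkpos⟩ := hdrop (2 * m) hm
    obtain ⟨hkL, -, hsupply⟩ := hdepth (2 * m + 1) (by omega) hrR
    have hsign : -W.rootNumber * (-1) ^ (2 * m + 1) = W.rootNumber := by
      rw [Odd.neg_one_pow ⟨m, rfl⟩]
      ring
    obtain ⟨n, hn, hdeep, hcard, d, hk1, hdisj⟩ := hsupply hkpos i u hi (fun j ↦ by rw [hsign]; exact hu j)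
    refine ⟨n, hn, hdeep, d, hkill (2 * m) hrR n hn hdeep hcard, ?_, ?_, ?_⟩
    · rw [horder (2 * m + 1) (by omega) hrR n d hn hdeep hcard hk1, hMreq, Nat.sub_sub_self hkL]
    · rw [hcard]
      exact hsign
    · exact hdisj.mono_left (zmultiples_le_of_mem (zsmul_mem_zmultiples _ _))
  · -- even depth `2m + 2`, sign `-w(E)`, McCallum's `C` generated by `u` AND the seed `c_L(1)`
    obtain ⟨hMreq, hrR, hkpos⟩ := hdrop (2 * m + 1) hm
    obtain ⟨hkL, -, hsupply⟩ := hdepth (2 * m + 2) (by omega) hrR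
    have hsign : -W.rootNumber * (-1) ^ (2 * m + 2) = -W.rootNumber := by
      rw [Even.neg_one_pow ⟨m + 1, by ring⟩]
      ring
    have hdiv : ∀ P : geomPoints (W.baseChange K), ∃ Q : geomPoints (W.baseChange K), ((2 ^ L : ℕ) : ℤ) • Q = P :=
      (W.baseChange K).zsmul_geomPoints_surjective_of_charZero hn0
    obtain ⟨P₀, hP₀⟩ := McCallum1991.exists_map_eq_derivedPoint_one' hIQ d₁
    obtain ⟨hsel1, hc1, hsgn1⟩ := kummerMapTorsion_bottom_mem_selmerGroup_and_conjAct (W := W) (Dt := Dt) (β := β) (ι := ι)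
      hIQ h3 hne4 hodd hHe hsurj1 τ hτ hL1 hdiv d₁ P₀ hP₀
    rw [← hc1] at hsel1 hsgn1
    obtain ⟨n, hn, hdeep, hcard, d, hk1, hdisj⟩ := hsupply hkpos (i + 1) (Fin.cons (d₁.kolyvaginClass Nat.prime_two L) u)
      (by omega) (fun j ↦ by
        rw [hsign]
        refine Fin.cases ?_ (fun j ↦ ?_) j
        · rw [Fin.cons_zero]
          exact ⟨hsel1, hsgn1⟩
        · rw [Fin.cons_succ]
          exact hu j)
    refine ⟨n, hn, hdeep, d, hkill (2 * m + 1) hrR n hn hdeep hcard, ?_, ?_, ?_⟩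
    · rw [horder (2 * m + 2) (by omega) hrR n d hn hdeep hcard hk1, hMreq, Nat.sub_sub_self hkL]
    · rw [hcard]
      exact hsign
    · refine (hdisj.mono_left (zmultiples_le_of_mem (zsmul_mem_zmultiples _ _))).mono_right (sup_le ?_ ?_)
      · exact closure_mono (by
          rintro x ⟨j, rfl⟩
          exact ⟨j.succ, Fin.cons_succ _ _ _⟩)
      · exact zmultiples_le_of_mem (subset_closure ⟨0, Fin.cons_zero _ _⟩)

/-- **STUB L's CONCLUSION ON ITS OWN FRAME FROM (P52÷) ALONE** — McCallum's Prop. 5.2 at `2` in Kolyvagin's divisibility currency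
(level `L`, deep levels, both signs, bottom rung `2 ∤ P(n)`), asked only when `M₀ ≥ 1`; composition of `kolyvaginSuppliesAtTwo_of_prop52Div`
and `twinShaLadders_of_kolyvaginSuppliesAtTwo'` (at `M₀ = 0`: `T = 0`). [cite: McCallumLMS1991, §5 Prop. 5.2, Thm. 5.4]
[cite: GrossLMS1991, Thm. 1.3, §4 (4.1), Prop. 5.3] -/
theorem twinShaLadders_of_prop52DivAtTwo (hP : PubInputsAtTwo) (hQ2 : KolyvaginRelationAtTwo)
    (W : WeierstrassCurve ℚ) [W.IsElliptic] [W.IsGloballyMinimal] [NeZero (W.conductorNorm ℤ)] (hcm : ¬ W.HasCM)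
    (hT : Odd W.tamagawaProduct) (K : Type) [Field K] [NumberField K] (hIQ : IsImaginaryQuadratic K)
    (hodd : Odd (NumberField.discr K)) (h3 : NumberField.discr K ≠ -3) (hHe : SatisfiesHeegnerHypothesis (W.conductorNorm ℤ) K)
    (hρ : ∀ n : ℕ, 0 < n → W.HasSurjectiveModNGaloisRep ((2 : ℤ) ^ n))
    (Dt : ModularParametrizationData W (W.conductorNorm ℤ)) (β : ℤ) (ι : K →+* ℂ) (d₁ : KolyvaginHeegnerData Dt β ι 1)
    (hy : ¬ IsOfFinAddOrder d₁.derivedPoint) (M₀ : ℕ)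
    (hM₀ : ∃ Q : (W.baseChange (ringClassField K ι 1)).toAffine.Point, ((2 ^ M₀ : ℕ) : ℤ) • Q = d₁.derivedPoint)
    (hndiv : ¬ ∃ Q : (W.baseChange (ringClassField K ι 1)).toAffine.Point, ((2 ^ (M₀ + 1) : ℕ) : ℤ) • Q = d₁.derivedPoint)
    (Wd : WeierstrassCurve ℚ) [Wd.IsElliptic] (hTw : ∃ C : VariableChange ℚ, C • W.quadraticTwist (NumberField.discr K : ℚ) = Wd)
    (hKS : 0 < M₀ → ∀ τ : K ≃ₐ[ℚ] K, τ ≠ 1 → ∃ (L R : ℕ) (k : ℕ → ℕ), M₀ + 1 ≤ L ∧ 1 ≤ R ∧ k R = L ∧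
      ∀ r : ℕ, 1 ≤ r → r ≤ R →
        k r ≤ L ∧
        (∀ (n : ℕ) (d : KolyvaginHeegnerData Dt β ι n), Squarefree n →
          (∀ ℓ ∈ n.primeFactors, Zhang2014.IsKolyvaginPrime (W.conductorNorm ℤ) W K 2 ℓ ∧ L ≤ Zhang2014.kolyvaginIndex W 2 ℓ) →
          n.primeFactors.card = r →
          ∃ B : (W.baseChange (ringClassField K ι n)).toAffine.Point, ((2 ^ (L - k r) : ℕ) : ℤ) • B = d.derivedPoint) ∧
        (0 < k r → ∀ (i : ℕ) (u : Fin i → galH1Torsion (W.baseChange K) ((2 ^ L : ℕ) : ℤ)), i ≤ r →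
          (∀ j, u j ∈ selmerGroup (W.baseChange K) ((2 ^ L : ℕ) : ℤ) ∧
            conjAct W τ ((2 ^ L : ℕ) : ℤ) (u j) = (-W.rootNumber * (-1) ^ r) • u j) →
          ∃ (n : ℕ) (_ : Squarefree n)
            (_ : ∀ ℓ ∈ n.primeFactors, Zhang2014.IsKolyvaginPrime (W.conductorNorm ℤ) W K 2 ℓ ∧ L ≤ Zhang2014.kolyvaginIndex W 2 ℓ)
            (_ : n.primeFactors.card = r) (d : KolyvaginHeegnerData Dt β ι n),
            (¬ ∃ B : (W.baseChange (ringClassField K ι n)).toAffine.Point, ((2 ^ (L - k r + 1) : ℕ) : ℤ) • B = d.derivedPoint) ∧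
            Disjoint (zmultiples (d.kolyvaginClass Nat.prime_two L)) (AddSubgroup.closure (Set.range u)))) :
    ∃ (T : ℕ) (M : ℕ → ℕ), (∀ j, M (j + 1) ≤ M j) ∧ M 0 = M₀ ∧ M (2 * T) = 0 ∧
      (∀ m < T, ∃ x : Fin (2 * m + 2) → W.galH1, (∀ i, resBaseChange W K (x i) ∈ (W.baseChange K).sha) ∧
        (∀ i, addOrderOf (x i) = 2 ^ (M (2 * m) - M (2 * m + 1))) ∧
        ∀ c : Fin (2 * m + 2) → ℤ, ∑ i, c i • x i = 0 → ∀ i, ((2 ^ (M (2 * m) - M (2 * m + 1)) : ℕ) : ℤ) ∣ c i) ∧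
      (∀ m < T, ∃ x : Fin (2 * m + 2) → Wd.galH1, (∀ i, resBaseChange Wd K (x i) ∈ (Wd.baseChange K).sha) ∧
        (∀ i, addOrderOf (x i) = 2 ^ (M (2 * m + 1) - M (2 * m + 2))) ∧
        ∀ c : Fin (2 * m + 2) → ℤ, ∑ i, c i • x i = 0 → ∀ i, ((2 ^ (M (2 * m + 1) - M (2 * m + 2)) : ℕ) : ℤ) ∣ c i) := by
  rcases Nat.eq_zero_or_pos M₀ with rfl | hpos
  · exact ⟨0, fun _ ↦ 0, fun _ ↦ le_rfl, rfl, rfl, fun m hm ↦ absurd hm (Nat.not_lt_zero m),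
      fun m hm ↦ absurd hm (Nat.not_lt_zero m)⟩
  · exact twinShaLadders_of_kolyvaginSuppliesAtTwo' hP hQ2 W hcm hT K hIQ hodd h3 hHe hρ Dt β ι d₁ hy M₀ hndiv Wd hTw
      (kolyvaginSuppliesAtTwo_of_prop52Div W K hIQ hodd h3 hHe (hρ 1 one_pos) Dt β ι d₁ M₀ hM₀ (hKS hpos))

end Summit.BirchSwinnertonDyer.BirchSwinnertonDyer.Theorems.GenusExact.PlusDescent

end
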